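import Literature.MathematicalPhysics.QuantumFieldTheory.Balaban1983to89.B9Cor36GCubeLocDefectCore

/-!
# `Balaban1983to89.B9Cor36GCubeFamFourCore` — THE FOURTH FAMILY OF (3.105)∕(3.106) p. 414 AT THE (R)-DESIGN CUBE LETTERS: the words `M_{ζ_□}·P1l_□·O_□·M_{h_□}` and
# `M_{h_□}·O_□·P1l_□` of M5.7's `hrest` ∕ `hV′` as member-side sandwiches `M_·∘R(u)⁻¹∘[core]∘R(u)∘M_·` of the cube-side cores `P_{□,1}(∂h_□)(Ṽ)·M_{χ_□}·G_□(Ṽ)`,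
# `M_{χ_□}·G_□(Ṽ)·M_{χ_□}·P_{□,1}(∂h_□)(Ṽ)`, their [4]-(2.83) cube-side block majorants (flat: the smallness is α-1's `M⁻¹`), and the member-side majorant of the
# first word per cube (sub-row G-B9-LETTERS, module M5.1b-G, GAPS G-B9-07 «Σ_□ ζ_□̃P_{□,1}(∂h_□)G_□h_□»; programme FAMFOUR, FILE α-2)

T. Bałaban, *Propagators for lattice gauge theories in a background field*, Commun. Math. Phys. **99** (1985) 389–434
[`Balaban1985BackgroundPropagators`, "B9"]; [4] = T. Bałaban, *Propagators and renormalization transformations for lattice gauge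
theories. II*, Commun. Math. Phys. **96** (1984) 223–250 [`Balaban1984PropagatorsII`].

statement-level skeleton of published theorems with citation tags; proofs where landed; nothing here is a claim about the
Yang–Mills mass gap

THE PRINTED LOCUS (verbatim up to notation; held `paper:balaban1985-cmp99-background-propagators`, journal page = PDF page + 388; page owner r06).  (3.105) p. 414:
«Δ_aG₀ = I − Σ_□K(h_□)G_□h_□ − Σ_□(1 − ζ_□̃)DPD\*h_□G_□h_□ − Σ_□ζ_□̃(DPD\* − DP_□D\*)h_□G_□h_□ − Σ_□ζ_□̃P_{□,1}(∂h_□)G_□h_□ = I − R»; (3.106) p. 414 (the transposed law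
`G₀Δ_a = I − R′`); p. 414 after (3.103): «the operator P₁(∂h) satisfies (3.49) with the additional small factor O(M⁻¹)»; (3.87) p. 409 («G₀ = Σ_□ h_□G_□h_□»); Cor. 3.6
p. 408 l. 1–14 and p. 409 l. 1–5 (the cube letters `G_□(U)` «satisfy all the inequalities of Theorems 3.1–3.3»); (3.34) p. 396 (the gauge transport `R(u)`); [4]
(2.51)–(2.55) p. 232, (2.83)–(2.85) pp. 237–238, Lemma 2.1 (2.61) p. 234, p. 398 of [B9] (scale-transfer remark).

WHY THIS FILE (cell `lit-balaban`; seat p38 gen 46; lead g34 RECEIPTS #71 «(α) GO TO SCOPE»; statement list HOME/INBOX 2026-08-28T22:28Z).  M5.7's consumer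
`B9Thm310DeltaAIsUnitOfExpansion.eBlock_kernelFamilyBInv_GAY_of_localInverseCubes''` displays in `hrest` the cover sum `Σ_□ conj b((M_{ζ_□}·P1l_□·O_□(U₁)·M_{h_□})^ℝ)`
(flat member kernel) and in `hV′` the sum `−Σ_□ conj b((M_{h_□}·O_□(U₁)·P1l_□)^ℝ)` (source-weighted kernel).  At the (R)-design letters of G-F2 `B9Cor36GCubeLocLetter`
— `O_□ = M_χR(u)⁻¹G_□(Ṽ)R(u)M_χ`, `Pl_□ = R(u)⁻¹DP_□D*(Ṽ)R(u)`, `P1l_□ = Pl_□M_h − M_hPl_□` — both words are SANDWICHES of a cube-side core between the gauge transport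
and real cut-offs (§1: `R(u)` commutes with multipliers, `χ_□h_□ = h_□`), so the landed machinery of programme DEFECT-R applies: p21's flat [4]-(2.83) engine
`B9Thm39CinvSepMiddle.sepMiddle_majorant_blk₀` composes α-1's `conj b(P_{□,1}(∂h_□)(Ṽ)) ≺ K₁·ℓ⁻²e^{−a₁δ₀d_□}` (the `M⁻¹` inside `K₁`) with G-F5∕G-F7's
`GVK(Ṽ) ≺ B_G·ℓ²e^{−b_Gδ₀d_□}` through `M_{χ_□}` (`|χ_□| ≤ 1`; no separation is needed — the smallness is `M⁻¹`, not a distance) (§2), and p38's G-F6b-T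
`B9Cor36BondSandwichTransfer.hasMajorant_conj_bond_sandwich` carries the first word to the member's blocks with the COLUMN indicator of the sources in `supp h_□`
(§3; the cover sum is α-3).  The second word has NO source cut-off near □ (its source side is the cube letter `P_{□,1}(∂h_□)` itself): its member-side majorant needs
the source-global transfer of FILE α-T and is NOT in this file.

WHAT THIS FILE PROVES (THEOREMS; 0 `def`, 0 `def … : Prop`, 0 sorry; standard axioms).
* §1 `locP1BY_eq_conj` (`P1l_□ = R(u)⁻¹·P_{□,1}(∂h)(Ṽ)·R(u)`), ★ `famFour_eq_sandwich` (`M_ζ·P1l_□·O_□·M_{h_□} = M_ζ ∘ R(u)⁻¹ ∘ [P_{□,1}(∂h_□)·M_{χ_□}·G_□(Ṽ)] ∘ R(u) ∘ M_{h_□}`,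
  realified, G-F6b-T's shape), ★ `famFourT_eq_sandwich` (`M_{h_□}·O_□·P1l_□ = M_{h_□} ∘ R(u)⁻¹ ∘ [M_{χ_□}·G_□(Ṽ)·M_{χ_□}·P_{□,1}(∂h_□)] ∘ R(u)`, realified).
* §2 `conj_core_F4_eq`, `conj_core_F4T_eq` (the realified cores as `conj b(P1)·mulOp χ♭·GVK`, `mulOp χ♭·GVK·mulOp χ♭·conj b(P1)`); ★★ `hasMajorant_core_F4`:
  `conj b(P1^ℝ) ≺ K₁ℓ_□(a)⁻²e^{−a₁δ₀d_□}` (`hP1`), `GVK ≺ B_Gℓ_□(y)²e^{−b_Gδ₀d_□}` (`hG`), (2.61) at `b_G − ρ`, the transfer of `ℓ²` at `α_st`, `α_st + ρ ≤ a₁` ⟹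
  `conj b((P1·M_χ·G_□)^ℝ) ≺ K₁B_GΛc₁(δ₀, b_G − ρ)·e^{−ρδ₀d_□}`; ★★ `hasMajorant_core_F4T` (reversed: (2.61) at `a₁ − ρ`, transfer of `ℓ⁻²`, `α_st + ρ ≤ b_G`).
* §3 ★★ `hasMajorant_conj_famFour` — THE MEMBER-SIDE MAJORANT OF `conj b((M_ζ·P1l_□·O_□·M_{h_□})^ℝ)` PER CUBE under §2's data, a bi-contractive gauge `u` and ANY real
  `ζ` with `|ζ| ≤ 1`: `≺ (M₂Σ‖b_j‖)²·𝟙^col_□(a′)·(K₁B_GΛc₁)·e^{−ρδ₀·d(a,a′)}` over the member's `(toB6 (geo9K i) Rr′ Hp, ιB∘blkV1)`, `𝟙^col_□(a′)` = «the member block `a′`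
  holds a bond whose cube block meets `supp h_□`» (p33's D2 indicator, on the COLUMN; summable over □ by D3's `sum_rowInd_le`).

HONEST SCOPE ∕ NOT CLAIMED.  Finite operator algebra + [4] (2.51)∕(2.83) bookkeeping over landed modules; `hP1`, `hG`, (2.61), the scale transfers are HYPOTHESES here
(suppliers: α-1 `hasMajorant_conj_P1CubeY_at_locCfg`, G-F7 `cor36_G_cube_at_locCfg'`, p33 `exists_h261_geoCK` ∕ `hST_geoCK`; the plug is α-3); `ζ` is ANY real
profile with `|ζ| ≤ 1` (print's `ζ_□̃`, p. 414, is one such; its support plays no role for THIS family); (R)-design letters read at `Ṽ` and transported by `R(u)` —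
print's `G_□`, `P_□` on the cube sequence need no transport.  NOT here: the member side of the second word and both cover sums (α-T, α-3), families 2–3.  NOT a node
discharge; no summit ∕ sub-problem statement is proved; nothing continuum ∕ OS ∕ mass-gap ∕ Clay; YM mass gap NOT proved by any of this (Track A conditional rung).
No `sorry`, no `axiom`, no `… : Prop` fact, no `instance`, no `notation`, no `def`.  NEW file; nothing landed is modified.  `--supports stmt-QuantumFields-19200` as
helper.  Net new unproved facts: 0.

RELATED IN THE TREE, NOT DUPLICATED (searched 2026-08-28: `rg 'locP1BY' Literature/` = G-F2 (definition, `locProjBY_mul_cutMulY`) + docstrings only; `rg 'famFour'` = ∅):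
p33 D1∕D2 `B9Cor36GCubeLocDefectTransfer` ∕ `B9Cor36GCubeLocDefectCore` (the defect words — the pattern followed here, lemmas USED BY NAME: `chiY_mul_hTY`,
`nearH_of_hTY_ne_zero`, `abs_hBdY_hTY_le_one`), p21 `B9Thm39CinvSepMiddle.sepMiddle_majorant_blk₀`, p38 `B9Cor36BondSandwichTransfer.hasMajorant_conj_bond_sandwich`,
`B9Cor36SiteSandwichTransfer.dist_member_le_dist_cube`, G-F2 `B9Cor36GCubeLocLetter` (letters, `cutMulY_mul_conjY_eq`, `cutMulY_hBdY_mul_of_eq`,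
`conjY_mul_conjY_inv_eq_one`), α-1 `B9Ineq3101POneCubeAtLocCfg`.
-/

noncomputable section

namespace Literature.MathematicalPhysics.QuantumFieldTheory.Balaban1983to89.B9Cor36GCubeFamFourCore

open B6RandomWalk (HasMajorant hasMajorant_mono Ineq261 c1_nonneg)
open B9Thm34Ext (toB6)
open B9Thm37Sum (mulOp mulOp_apply)
open B9Ineq347 (ScaleTransfer)
open B9Eq352DivFormLetters (conj)
open B9Eq39Adjoint (R)
open B9Eq310Hermitian (norm_R_le norm_R_inv_le)
open B6KLevelCensusIndexV1 (KIdx)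
open B6Cover236MultiLevelBlocks (cubes)
open B6GlobalChartV1 (blkV1)
open B6Geom246MultiLevelBox (blkOf)
open B6Ineq2142KLevelV1 (β)
open B9GeoNormsKLevelV1 (geo9K)
open B9Thm37CubeCoverCommutators (cutMulY cutMulY_apply hTY hTY_apply)
open B9Thm39CinvTorusRegular (conj_cutMulY)
open B9Thm39CinvSepMiddle (sepMiddle_majorant_blk₀)
open B9Eq3104CutoffCommutators (hBdY hBdY_apply cutCommR)
open B9Eq3105AtLetters (DPDsCubeY P1CubeY)
open B9CubeLettersBondOpsL0 (BlkCubeY GACubeY)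
open B9Eq360DeltaPrimeACubeY (blkCubeY)
open B9CubeGeometryInputs (geoCK geoCK_len_pos geoCK_dist_axioms)
open B9Cor35GCubeInputsAtOne (blkBK GVK)
open B9Cor36CubeCutoffs (chiY abs_chiY_le_one)
open B9Cor36GCubeLocLetter (locLetterBY locProjBY locP1BY locLetterBY_def cutMulY_mul_conjY_eq cutMulY_hBdY_mul_of_eq conjY_mul_conjY_inv_eq_one)
open B9Cor36GCubeLocDefectTransfer (chiY_mul_hTY nearH_of_hTY_ne_zero abs_hBdY_hTY_le_one)
open B9Cor36BondSandwichTransfer (hasMajorant_conj_bond_sandwich)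
open B9Cor36SiteSandwichTransfer (dist_member_le_dist_cube)
open Node00 (SiteY BlkY IBondY FBondY CfgY GaugeY SiteParY BondParY toKT conjY gBondY)
open Node00.OpsYNablaBridge (chartY)

variable {d ℓ : ℕ} {hd : 1 ≤ d + 1} {hL : Odd (ℓ + 1) ∧ 1 < ℓ + 1} {b₀ b₁ : ℝ}
variable {𝔸 : Type} [NormedRing 𝔸] [NormedAlgebra ℂ 𝔸] [CompleteSpace 𝔸]
variable {ι : Type} [Fintype ι]

/-! ## §1  The two words of the fourth family as sandwiches `M_· ∘ R(u)⁻¹ ∘ [core] ∘ R(u) ∘ M_·` -/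

section Identity

variable (i : KIdx d ℓ hd hL b₀ b₁) (c : ↥(cubes (toKT i).D.toDomains)) (parS : SiteParY 𝔸 i) (parB : BondParY 𝔸 i)

/-- **`P1l_□ = R(u)⁻¹·P_{□,1}(∂h)(Ṽ)·R(u)`** — the transported projection's (3.101) commutator is the transport of the cube letter's commutator, because `R(u)` commutes
with real multipliers. [cite: Balaban1985BackgroundPropagators, (3.101) p.414, (3.105) p.414, (3.34) p.396] -/
theorem locP1BY_eq_conj (g : GaugeY 𝔸 i) (h : SiteY i → ℝ) (V : CfgY 𝔸 i) :
    locP1BY i c parS g h V = conjY (gBondY i g)⁻¹ * P1CubeY i c h parS V * conjY (gBondY i g) := by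
  have e : P1CubeY i c h parS V = DPDsCubeY i c parS V * cutMulY (hBdY i h) - cutMulY (hBdY i h) * DPDsCubeY i c parS V := by
    rw [P1CubeY, cutCommR, neg_sub]; rfl
  rw [locP1BY, locProjBY, e, mul_sub, sub_mul]
  congr 1
  · simp only [mul_assoc, cutMulY_mul_conjY_eq]
  · simp only [← mul_assoc, cutMulY_mul_conjY_eq]

/-- ★ **THE `hrest` WORD AS A SANDWICH**: `M_ζ·P1l_□·O_□·M_{h_□} = M_ζ ∘ R(u)⁻¹ ∘ [P_{□,1}(∂h_□)(Ṽ)·M_{χ_□}·G_□(Ṽ)] ∘ R(u) ∘ M_{h_□}` at `χ = χ_□`, `h = h_□` (realified;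
`R(u)M_χR(u)⁻¹ = M_χ`, `M_χM_h = M_h`). [cite: Balaban1985BackgroundPropagators, (3.105) p.414, (3.87) p.409, (3.34) p.396; Balaban1984PropagatorsII, (2.79)–(2.82) p.237] -/
theorem famFour_eq_sandwich (g : GaugeY 𝔸 i) (ζ : SiteY i → ℝ) (V : CfgY 𝔸 i) :
    (cutMulY (𝔸 := 𝔸) (hBdY i ζ) * locP1BY i c parS g (hTY i c) V * locLetterBY i c parS parB g (chiY i c) V * cutMulY (hBdY i (hTY i c))).restrictScalars ℝ =
      (cutMulY (𝔸 := 𝔸) (hBdY i ζ)).restrictScalars ℝ ∘ₗ (conjY (gBondY i g)⁻¹).restrictScalars ℝ ∘ₗ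
        ((P1CubeY i c (hTY i c) parS V * cutMulY (hBdY i (chiY i c)) * GACubeY i c parS parB V).restrictScalars ℝ) ∘ₗ
        (conjY (gBondY i g)).restrictScalars ℝ ∘ₗ (cutMulY (𝔸 := 𝔸) (hBdY i (hTY i c))).restrictScalars ℝ := by
  have e : cutMulY (𝔸 := 𝔸) (hBdY i ζ) * locP1BY i c parS g (hTY i c) V * locLetterBY i c parS parB g (chiY i c) V * cutMulY (hBdY i (hTY i c)) =
      cutMulY (hBdY i ζ) * conjY (gBondY i g)⁻¹ * (P1CubeY i c (hTY i c) parS V * cutMulY (hBdY i (chiY i c)) * GACubeY i c parS parB V) *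
        conjY (gBondY i g) * cutMulY (hBdY i (hTY i c)) := by
    rw [locP1BY_eq_conj, locLetterBY_def]
    simp only [mul_assoc]
    rw [cutMulY_hBdY_mul_of_eq i (chiY i c) (hTY i c) (chiY_mul_hTY i c), ← mul_assoc (conjY (gBondY i g)) (cutMulY (hBdY i (chiY i c))) _,
      ← cutMulY_mul_conjY_eq, mul_assoc (cutMulY (hBdY i (chiY i c))) (conjY (gBondY i g)) _,
      ← mul_assoc (conjY (gBondY i g)) (conjY (gBondY i g)⁻¹) _, conjY_mul_conjY_inv_eq_one, one_mul]
  rw [e]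
  exact LinearMap.ext fun _ => rfl

/-- ★ **THE `hV′` WORD AS A SANDWICH** (no source cut-off): `M_{h_□}·O_□·P1l_□ = M_{h_□} ∘ R(u)⁻¹ ∘ [M_{χ_□}·G_□(Ṽ)·M_{χ_□}·P_{□,1}(∂h_□)(Ṽ)] ∘ R(u)` (realified;
`M_χR(u)⁻¹ = R(u)⁻¹M_χ`, `R(u)M_χR(u)⁻¹ = M_χ`). [cite: Balaban1985BackgroundPropagators, (3.106) p.414, (3.87) p.409, (3.34) p.396; Balaban1984PropagatorsII, (2.79)–(2.82) p.237] -/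
theorem famFourT_eq_sandwich (g : GaugeY 𝔸 i) (V : CfgY 𝔸 i) :
    (cutMulY (𝔸 := 𝔸) (hBdY i (hTY i c)) * locLetterBY i c parS parB g (chiY i c) V * locP1BY i c parS g (hTY i c) V).restrictScalars ℝ =
      (cutMulY (𝔸 := 𝔸) (hBdY i (hTY i c))).restrictScalars ℝ ∘ₗ (conjY (gBondY i g)⁻¹).restrictScalars ℝ ∘ₗ
        ((cutMulY (hBdY i (chiY i c)) * GACubeY i c parS parB V * cutMulY (hBdY i (chiY i c)) * P1CubeY i c (hTY i c) parS V).restrictScalars ℝ) ∘ₗ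
        (conjY (gBondY i g)).restrictScalars ℝ := by
  have e : cutMulY (𝔸 := 𝔸) (hBdY i (hTY i c)) * locLetterBY i c parS parB g (chiY i c) V * locP1BY i c parS g (hTY i c) V =
      cutMulY (hBdY i (hTY i c)) * conjY (gBondY i g)⁻¹ *
        (cutMulY (hBdY i (chiY i c)) * GACubeY i c parS parB V * cutMulY (hBdY i (chiY i c)) * P1CubeY i c (hTY i c) parS V) * conjY (gBondY i g) := by
    rw [locP1BY_eq_conj, locLetterBY_def]
    simp only [mul_assoc]
    rw [← mul_assoc (conjY (gBondY i g)) (cutMulY (hBdY i (chiY i c))) _, ← cutMulY_mul_conjY_eq,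
      mul_assoc (cutMulY (hBdY i (chiY i c))) (conjY (gBondY i g)) _,
      ← mul_assoc (conjY (gBondY i g)) (conjY (gBondY i g)⁻¹) _, conjY_mul_conjY_inv_eq_one, one_mul,
      ← mul_assoc (cutMulY (hBdY i (chiY i c))) (conjY (gBondY i g)⁻¹) _, cutMulY_mul_conjY_eq, mul_assoc]
  rw [e]
  exact LinearMap.ext fun _ => rfl

end Identity

/-! ## §2  The cube-side cores and their flat [4]-(2.83) majorants -/

section Core

variable (i : KIdx d ℓ hd hL b₀ b₁) (c : ↥(cubes (toKT i).D.toDomains)) (parS : SiteParY 𝔸 i) (parB : BondParY 𝔸 i) (b : Module.Basis ι ℝ 𝔸)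

/-- the realified core of the `hrest` word is `conj b(P_{□,1}(∂h)(Ṽ))·mulOp χ♭·GVK(Ṽ)`. [cite: Balaban1985BackgroundPropagators, (3.105) p.414, (3.87) p.409; Balaban1984PropagatorsII, (2.52) p.232] -/
theorem conj_core_F4_eq (χ h : SiteY i → ℝ) (V : CfgY 𝔸 i) :
    conj b ((P1CubeY i c h parS V * cutMulY (𝔸 := 𝔸) (hBdY i χ) * GACubeY i c parS parB V).restrictScalars ℝ) =
      conj b ((P1CubeY i c h parS V).restrictScalars ℝ) * mulOp (fun p : FBondY i × ι => hBdY i χ p.1) * GVK b i c parS parB V := by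
  have hsplit : ((P1CubeY i c h parS V * cutMulY (𝔸 := 𝔸) (hBdY i χ) * GACubeY i c parS parB V).restrictScalars ℝ : Module.End ℝ (FBondY i → 𝔸)) =
      (P1CubeY i c h parS V).restrictScalars ℝ * (cutMulY (𝔸 := 𝔸) (hBdY i χ)).restrictScalars ℝ * (GACubeY i c parS parB V).restrictScalars ℝ :=
    LinearMap.ext fun _ => rfl
  rw [hsplit, B9Eq352DivFormLetters.conj_mul, B9Eq352DivFormLetters.conj_mul, conj_cutMulY]
  rfl

/-- the realified core of the `hV′` word is `mulOp χ♭·GVK(Ṽ)·mulOp χ♭·conj b(P_{□,1}(∂h)(Ṽ))`. [cite: Balaban1985BackgroundPropagators, (3.106) p.414, (3.87) p.409; Balaban1984PropagatorsII, (2.52) p.232] -/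
theorem conj_core_F4T_eq (χ h : SiteY i → ℝ) (V : CfgY 𝔸 i) :
    conj b ((cutMulY (𝔸 := 𝔸) (hBdY i χ) * GACubeY i c parS parB V * cutMulY (hBdY i χ) * P1CubeY i c h parS V).restrictScalars ℝ) =
      mulOp (fun p : FBondY i × ι => hBdY i χ p.1) * GVK b i c parS parB V * mulOp (fun p : FBondY i × ι => hBdY i χ p.1) *
        conj b ((P1CubeY i c h parS V).restrictScalars ℝ) := by
  have hsplit : ((cutMulY (𝔸 := 𝔸) (hBdY i χ) * GACubeY i c parS parB V * cutMulY (hBdY i χ) * P1CubeY i c h parS V).restrictScalars ℝ :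
        Module.End ℝ (FBondY i → 𝔸)) =
      (cutMulY (𝔸 := 𝔸) (hBdY i χ)).restrictScalars ℝ * (GACubeY i c parS parB V).restrictScalars ℝ * (cutMulY (𝔸 := 𝔸) (hBdY i χ)).restrictScalars ℝ *
        (P1CubeY i c h parS V).restrictScalars ℝ :=
    LinearMap.ext fun _ => rfl
  rw [hsplit, B9Eq352DivFormLetters.conj_mul, B9Eq352DivFormLetters.conj_mul, B9Eq352DivFormLetters.conj_mul, conj_cutMulY]
  rfl

omit [NormedAlgebra ℂ 𝔸] [CompleteSpace 𝔸] [Fintype ι] in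
/-- `mulOp 1 = 1`. [cite: Balaban1984PropagatorsII, (2.52) p.232, bookkeeping] -/
theorem mulOp_const_one {X : Type} : (mulOp fun _ : X => (1 : ℝ)) = 1 :=
  LinearMap.ext fun μ => funext fun x => by rw [mulOp_apply, one_mul, Module.End.one_apply]

omit [Fintype ι] in
/-- `|χ_□♭| ≤ 1` on the bond carrier. [cite: Balaban1985BackgroundPropagators, (3.87) p.409; Balaban1984PropagatorsII, (2.36) p.229] -/
theorem abs_chi_flat_le_one (p : FBondY i × ι) : |hBdY i (chiY i c) p.1| ≤ 1 := by
  rw [hBdY_apply]; exact (abs_chiY_le_one i c _).1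

open Classical in
set_option maxHeartbeats 1600000 in
/-- ★★ **THE CUBE-SIDE MAJORANT OF THE CORE OF THE `hrest` WORD** ([4] (2.83), flat): `conj b(P_{□,1}(∂h_□)(Ṽ)^ℝ) ≺ K₁·ℓ_□(a)⁻²·e^{−a₁δ₀d_□}` (`hP1`, α-1; its `K₁`
carries the `M⁻¹`), `GVK(Ṽ) ≺ B_G·ℓ_□(y)²·e^{−b_Gδ₀d_□}` (`hG`), (2.61) at `b_G − ρ`, the scale transfer `e^{−α_stδ₀d_□(a,y)}ℓ_□(y)² ≦ Λ·ℓ_□(a)²`, `α_st + ρ ≦ a₁` ⟹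
`conj b((P_{□,1}(∂h_□)·M_{χ_□}·G_□(Ṽ))^ℝ) ≺ K₁B_GΛ·c₁(δ₀, b_G − ρ)·e^{−ρδ₀d_□(a,b′)}` — the weights `ℓ⁻²·ℓ²` cancel; `|χ_□| ≤ 1` in the middle (p21's engine).
[cite: Balaban1985BackgroundPropagators, (3.105) p.414, p.414 (after (3.103)), (3.87) p.409, Cor. 3.6 p.408; Balaban1984PropagatorsII, (2.83)–(2.85) pp.237–238, (2.52)–(2.55) p.232, Lemma 2.1 (2.61) p.234] -/
theorem hasMajorant_core_F4 (V : CfgY 𝔸 i) (Rr : ℝ) (H : Prop) (dB : ℕ) {δ₀ a1 bG αst ρ K1 BG Λ : ℝ}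
    (hδ₀ : 0 ≤ δ₀) (hK1 : 0 ≤ K1) (hBG : 0 ≤ BG) (hΛ : 0 ≤ Λ) (hρ : 0 ≤ ρ) (hsplit : αst + ρ ≤ a1)
    (h261 : Ineq261 dB (toB6 (geoCK i c) Rr H) δ₀ (bG - ρ)) (hST : ScaleTransfer (geoCK i c) δ₀ αst Λ (fun a => (geoCK i c).len a ^ 2))
    (hP1 : HasMajorant (g := toB6 (geoCK i c) Rr H) (blkBK i c) (conj b ((P1CubeY i c (hTY i c) parS V).restrictScalars ℝ))
      (fun a y => K1 * ((geoCK i c).len a ^ 2)⁻¹ * Real.exp (-(a1 * δ₀ * (geoCK i c).dist a y))))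
    (hG : HasMajorant (g := toB6 (geoCK i c) Rr H) (blkBK i c) (GVK b i c parS parB V)
      (fun y b' => BG * (geoCK i c).len y ^ 2 * Real.exp (-(bG * δ₀ * (geoCK i c).dist y b')))) :
    HasMajorant (g := toB6 (geoCK i c) Rr H) (blkBK i c)
      (conj b ((P1CubeY i c (hTY i c) parS V * cutMulY (𝔸 := 𝔸) (hBdY i (chiY i c)) * GACubeY i c parS parB V).restrictScalars ℝ))
      (fun a b' => K1 * BG * Λ * B6.c1 dB δ₀ (bG - ρ) * Real.exp (-(ρ * δ₀ * (geoCK i c).dist a b'))) := by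
  obtain ⟨hdnn, htri, -, hsymm⟩ := geoCK_dist_axioms i c Rr H
  have hℓ2 : ∀ a : BlkCubeY i c, 0 ≤ (geoCK i c).len a ^ 2 := fun a => sq_nonneg _
  have hℓ2i : ∀ a : BlkCubeY i c, 0 ≤ ((geoCK i c).len a ^ 2)⁻¹ := fun a => inv_nonneg.2 (hℓ2 a)
  have h := sepMiddle_majorant_blk₀ (R := Rr) (H := H) (blkBK i c) dB δ₀ a1 αst 0 ρ bG K1 BG Λ
    (fun a => ((geoCK i c).len a ^ 2)⁻¹) (fun a => (geoCK i c).len a ^ 2) (fun a => (geoCK i c).len a ^ 2) Finset.univ Finset.univ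
    (fun _ : FBondY i × ι => (1 : ℝ)) (fun p : FBondY i × ι => hBdY i (chiY i c) p.1)
    hK1 hBG hΛ hℓ2i hℓ2 hℓ2 hδ₀ le_rfl hρ (by linarith) htri hsymm hdnn hST h261 (fun _ => by norm_num) (fun p hp => absurd (Finset.mem_univ _) hp)
    (abs_chi_flat_le_one i c) (fun p hp => absurd (Finset.mem_univ _) hp) hP1 hG
  rw [mulOp_const_one, one_mul, ← conj_core_F4_eq] at h
  refine hasMajorant_mono (g := toB6 (geoCK i c) Rr H) _ h fun a b' => le_of_eq ?_
  have hw : ((geoCK i c).len a ^ 2)⁻¹ * (geoCK i c).len a ^ 2 = 1 := inv_mul_cancel₀ (pow_ne_zero 2 (geoCK_len_pos i c a).ne')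
  simp only [Finset.mem_univ, if_true, hw, one_mul, mul_one]

open Classical in
set_option maxHeartbeats 1600000 in
/-- ★★ **THE CUBE-SIDE MAJORANT OF THE CORE OF THE `hV′` WORD** (the factors reversed): `GVK(Ṽ) ≺ B_G·ℓ_□(a)²·e^{−b_Gδ₀d_□}` in front (`hG`), `conj b(P_{□,1}(∂h_□)(Ṽ)^ℝ) ≺
K₁·ℓ_□(y)⁻²·e^{−a₁δ₀d_□}` behind (`hP1`), (2.61) at `a₁ − ρ`, the scale transfer of `ℓ_□⁻²` at `α_st`, `α_st + ρ ≦ b_G` ⟹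
`conj b((M_{χ_□}·G_□(Ṽ)·M_{χ_□}·P_{□,1}(∂h_□))^ℝ) ≺ B_GK₁Λ·c₁(δ₀, a₁ − ρ)·e^{−ρδ₀d_□(a,b′)}`.
[cite: Balaban1985BackgroundPropagators, (3.106) p.414, p.414 (after (3.103)), (3.87) p.409, Cor. 3.6 p.408; Balaban1984PropagatorsII, (2.83)–(2.85) pp.237–238, (2.52)–(2.55) p.232, Lemma 2.1 (2.61) p.234] -/
theorem hasMajorant_core_F4T (V : CfgY 𝔸 i) (Rr : ℝ) (H : Prop) (dB : ℕ) {δ₀ a1 bG αst ρ K1 BG Λ : ℝ}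
    (hδ₀ : 0 ≤ δ₀) (hK1 : 0 ≤ K1) (hBG : 0 ≤ BG) (hΛ : 0 ≤ Λ) (hρ : 0 ≤ ρ) (hsplit : αst + ρ ≤ bG)
    (h261 : Ineq261 dB (toB6 (geoCK i c) Rr H) δ₀ (a1 - ρ)) (hST : ScaleTransfer (geoCK i c) δ₀ αst Λ (fun a => ((geoCK i c).len a ^ 2)⁻¹))
    (hG : HasMajorant (g := toB6 (geoCK i c) Rr H) (blkBK i c) (GVK b i c parS parB V)
      (fun a y => BG * (geoCK i c).len a ^ 2 * Real.exp (-(bG * δ₀ * (geoCK i c).dist a y))))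
    (hP1 : HasMajorant (g := toB6 (geoCK i c) Rr H) (blkBK i c) (conj b ((P1CubeY i c (hTY i c) parS V).restrictScalars ℝ))
      (fun y b' => K1 * ((geoCK i c).len y ^ 2)⁻¹ * Real.exp (-(a1 * δ₀ * (geoCK i c).dist y b')))) :
    HasMajorant (g := toB6 (geoCK i c) Rr H) (blkBK i c)
      (conj b ((cutMulY (𝔸 := 𝔸) (hBdY i (chiY i c)) * GACubeY i c parS parB V * cutMulY (hBdY i (chiY i c)) * P1CubeY i c (hTY i c) parS V).restrictScalars ℝ))
      (fun a b' => BG * K1 * Λ * B6.c1 dB δ₀ (a1 - ρ) * Real.exp (-(ρ * δ₀ * (geoCK i c).dist a b'))) := by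
  obtain ⟨hdnn, htri, -, hsymm⟩ := geoCK_dist_axioms i c Rr H
  have hℓ2 : ∀ a : BlkCubeY i c, 0 ≤ (geoCK i c).len a ^ 2 := fun a => sq_nonneg _
  have hℓ2i : ∀ a : BlkCubeY i c, 0 ≤ ((geoCK i c).len a ^ 2)⁻¹ := fun a => inv_nonneg.2 (hℓ2 a)
  have h := sepMiddle_majorant_blk₀ (R := Rr) (H := H) (blkBK i c) dB δ₀ bG αst 0 ρ a1 BG K1 Λ
    (fun a => (geoCK i c).len a ^ 2) (fun a => ((geoCK i c).len a ^ 2)⁻¹) (fun a => ((geoCK i c).len a ^ 2)⁻¹) Finset.univ Finset.univ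
    (fun p : FBondY i × ι => hBdY i (chiY i c) p.1) (fun p : FBondY i × ι => hBdY i (chiY i c) p.1)
    hBG hK1 hΛ hℓ2 hℓ2i hℓ2i hδ₀ le_rfl hρ (by linarith) htri hsymm hdnn hST h261 (abs_chi_flat_le_one i c) (fun p hp => absurd (Finset.mem_univ _) hp)
    (abs_chi_flat_le_one i c) (fun p hp => absurd (Finset.mem_univ _) hp) hG hP1
  rw [← conj_core_F4T_eq] at h
  refine hasMajorant_mono (g := toB6 (geoCK i c) Rr H) _ h fun a b' => le_of_eq ?_
  have hw : (geoCK i c).len a ^ 2 * ((geoCK i c).len a ^ 2)⁻¹ = 1 := mul_inv_cancel₀ (pow_ne_zero 2 (geoCK_len_pos i c a).ne')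
  simp only [Finset.mem_univ, if_true, hw, one_mul, mul_one]

end Core

/-! ## §3  The member-side majorant of the `hrest` word per cube (column indicator of the sources in `supp h_□`) -/

section Member

variable (i : KIdx d ℓ hd hL b₀ b₁) (c : ↥(cubes (toKT i).D.toDomains)) (parS : SiteParY 𝔸 i) (parB : BondParY 𝔸 i) (b : Module.Basis ι ℝ 𝔸)

open Classical in
/-- ★★ **THE MEMBER-SIDE MAJORANT OF `conj b((M_ζ·P1l_□·O_□·M_{h_□})^ℝ)` FROM ONE CUBE-SIDE DATUM** (any kernel): the core's majorant `K_C` over the cube blocks, a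
bi-contractive gauge `u`, `|ζ| ≤ 1`, and a member kernel `K ≥ 0` dominating `K_C` on every row and on the COLUMNS THAT MATTER (source site in `supp h_□`) give
`≺ (M₂Σ‖b_j‖)²·K` over the member's blocks (G-F6b-T at `g₁ = ζ♭`, `g₂ = h_□♭ ⊂ NearH`).
[cite: Balaban1985BackgroundPropagators, Cor. 3.6 p.408 l.11–14, (3.105) p.414, (3.87) p.409; Balaban1984PropagatorsII, (2.51)–(2.55) p.232] -/
theorem hasMajorant_conj_famFour_of_core {M₂ : ℝ} (hM₂ : 0 ≤ M₂) (hrepr : ∀ (v : 𝔸) (j : ι), |b.repr v j| ≤ M₂ * ‖v‖)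
    (g : GaugeY 𝔸 i) (hg : ∀ x, ‖((g x : 𝔸ˣ) : 𝔸)‖ ≤ 1 ∧ ‖(((g x)⁻¹ : 𝔸ˣ) : 𝔸)‖ ≤ 1) (V : CfgY 𝔸 i) (ζ : SiteY i → ℝ) (hζ1 : ∀ z, |ζ z| ≤ 1)
    (ιB : BlkY i → IBondY i) (hι : ∀ s, β i.hN i.D i.hk (ιB s) = s) (Rr : ℝ) (H : Prop) [Fintype (geo9K i).Site] (Rr' : ℝ) (Hp : Prop)
    {KC : BlkCubeY i c → BlkCubeY i c → ℝ} {K : IBondY i → IBondY i → ℝ} (hK : ∀ a a', 0 ≤ K a a')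
    (hcmp : ∀ x x₀ : FBondY i, hTY i c (chartY i x₀.src) ≠ 0 →
      KC (blkCubeY i c (chartY i x.src)) (blkCubeY i c (chartY i x₀.src)) ≤ K (ιB (blkOf i.D.toDomains (chartY i x.src))) (ιB (blkOf i.D.toDomains (chartY i x₀.src))))
    (hF : HasMajorant (g := toB6 (geoCK i c) Rr H) (blkBK i c)
      (conj b ((P1CubeY i c (hTY i c) parS V * cutMulY (𝔸 := 𝔸) (hBdY i (chiY i c)) * GACubeY i c parS parB V).restrictScalars ℝ)) KC) :
    HasMajorant (g := toB6 (geo9K i) Rr' Hp) (fun p : FBondY i × ι => ιB (blkV1 i.hN i.D p.1))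
      (conj b ((cutMulY (𝔸 := 𝔸) (hBdY i ζ) * locP1BY i c parS g (hTY i c) V * locLetterBY i c parS parB g (chiY i c) V *
        cutMulY (hBdY i (hTY i c))).restrictScalars ℝ))
      (fun a a' => (M₂ * ∑ j, ‖b j‖) ^ 2 * K a a') := by
  have hγ : ∀ (f : FBondY i) (a : 𝔸), ‖R (gBondY i g f) a‖ ≤ ‖a‖ ∧ ‖R (gBondY i g f)⁻¹ a‖ ≤ ‖a‖ := fun f a =>
    ⟨norm_R_le (hg _).1 (hg _).2 a, norm_R_inv_le (hg _).1 (hg _).2 a⟩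
  rw [famFour_eq_sandwich]
  refine hasMajorant_conj_bond_sandwich i c b hM₂ hrepr (gBondY i g) hγ (hBdY i ζ) (hBdY i (hTY i c)) (fun _ => 1) (fun _ => 1)
    (fun f => by rw [hBdY_apply]; exact hζ1 _) (abs_hBdY_hTY_le_one i c)
    (fun f hf => nearH_of_hTY_ne_zero i c (by rw [hBdY_apply] at hf; exact hf)) ιB hι Rr H Rr' Hp hK (fun x x₀ hx₀ => ?_) _ hF
  rw [hBdY_apply] at hx₀
  rw [one_mul, mul_one]
  exact hcmp x x₀ hx₀

open Classical in
set_option maxHeartbeats 1600000 in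
/-- ★★ **THE MEMBER-SIDE MAJORANT OF THE `hrest` WORD PER CUBE** (the fourth family of (3.105) at the (R)-design letters, modulo the cover sum): under the data of
`hasMajorant_core_F4`, a bi-contractive gauge `u` and `|ζ| ≤ 1`,
`conj b((M_ζ·P1l_□·O_□·M_{h_□})^ℝ) ≺ (M₂Σ‖b_j‖)²·𝟙^col_□(a′)·(K₁B_GΛc₁(δ₀, b_G − ρ))·e^{−ρδ₀·d(a,a′)}` over the member's `(toB6 (geo9K i) Rr′ Hp, ιB∘blkV1)`,
`𝟙^col_□(a′)` = «the member block `a′` holds a bond whose cube block meets `supp h_□`» (`d ≦ d_□`, p38's `dist_member_le_dist_cube`); the `M⁻¹` sits in `K₁`.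
[cite: Balaban1985BackgroundPropagators, (3.105) p.414, p.414 (after (3.103)), (3.87) p.409, Cor. 3.6 p.408; Balaban1984PropagatorsII, (2.83)–(2.85) pp.237–238, (2.51)–(2.55) p.232, Lemma 2.1 (2.61) p.234] -/
theorem hasMajorant_conj_famFour {M₂ : ℝ} (hM₂ : 0 ≤ M₂) (hrepr : ∀ (v : 𝔸) (j : ι), |b.repr v j| ≤ M₂ * ‖v‖)
    (g : GaugeY 𝔸 i) (hg : ∀ x, ‖((g x : 𝔸ˣ) : 𝔸)‖ ≤ 1 ∧ ‖(((g x)⁻¹ : 𝔸ˣ) : 𝔸)‖ ≤ 1) (V : CfgY 𝔸 i) (ζ : SiteY i → ℝ) (hζ1 : ∀ z, |ζ z| ≤ 1)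
    (ιB : BlkY i → IBondY i) (hι : ∀ s, β i.hN i.D i.hk (ιB s) = s) (Rr : ℝ) (H : Prop) [Fintype (geo9K i).Site] (Rr' : ℝ) (Hp : Prop)
    (dB : ℕ) {δ₀ a1 bG αst ρ K1 BG Λ : ℝ}
    (hδ₀ : 0 ≤ δ₀) (hK1 : 0 ≤ K1) (hBG : 0 ≤ BG) (hΛ : 0 ≤ Λ) (hρ : 0 ≤ ρ) (hsplit : αst + ρ ≤ a1)
    (h261 : Ineq261 dB (toB6 (geoCK i c) Rr H) δ₀ (bG - ρ)) (hST : ScaleTransfer (geoCK i c) δ₀ αst Λ (fun a => (geoCK i c).len a ^ 2))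
    (hP1 : HasMajorant (g := toB6 (geoCK i c) Rr H) (blkBK i c) (conj b ((P1CubeY i c (hTY i c) parS V).restrictScalars ℝ))
      (fun a y => K1 * ((geoCK i c).len a ^ 2)⁻¹ * Real.exp (-(a1 * δ₀ * (geoCK i c).dist a y))))
    (hG : HasMajorant (g := toB6 (geoCK i c) Rr H) (blkBK i c) (GVK b i c parS parB V)
      (fun y b' => BG * (geoCK i c).len y ^ 2 * Real.exp (-(bG * δ₀ * (geoCK i c).dist y b')))) :
    HasMajorant (g := toB6 (geo9K i) Rr' Hp) (fun p : FBondY i × ι => ιB (blkV1 i.hN i.D p.1))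
      (conj b ((cutMulY (𝔸 := 𝔸) (hBdY i ζ) * locP1BY i c parS g (hTY i c) V * locLetterBY i c parS parB g (chiY i c) V *
        cutMulY (hBdY i (hTY i c))).restrictScalars ℝ))
      (fun a a' => (M₂ * ∑ j, ‖b j‖) ^ 2 *
        ((if ∃ x : FBondY i, ιB (blkOf i.D.toDomains (chartY i x.src)) = a' ∧
              ∃ z : SiteY i, blkCubeY i c z = blkCubeY i c (chartY i x.src) ∧ hTY i c z ≠ 0
            then K1 * BG * Λ * B6.c1 dB δ₀ (bG - ρ) else 0) *
          Real.exp (-(ρ * δ₀ * (geo9K i).dist a a')))) := by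
  have hκ : 0 ≤ K1 * BG * Λ * B6.c1 dB δ₀ (bG - ρ) := mul_nonneg (mul_nonneg (mul_nonneg hK1 hBG) hΛ) (c1_nonneg _ _ _)
  refine hasMajorant_conj_famFour_of_core i c parS parB b hM₂ hrepr g hg V ζ hζ1 ιB hι Rr H Rr' Hp
    (fun a a' => mul_nonneg (by split_ifs <;> [exact hκ; exact le_rfl]) (Real.exp_nonneg _)) (fun x x₀ hx₀ => ?_)
    (hasMajorant_core_F4 i c parS parB b V Rr H dB hδ₀ hK1 hBG hΛ hρ hsplit h261 hST hP1 hG)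
  have hdD := dist_member_le_dist_cube i c ιB hι (chartY i x.src) (chartY i x₀.src)
  have hρδ : 0 ≤ ρ * δ₀ := mul_nonneg hρ hδ₀
  rw [if_pos ⟨x₀, rfl, chartY i x₀.src, rfl, hx₀⟩]
  exact mul_le_mul_of_nonneg_left (Real.exp_le_exp.2 (by nlinarith)) hκ

end Member

end Literature.MathematicalPhysics.QuantumFieldTheory.Balaban1983to89.B9Cor36GCubeFamFourCore

end
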